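import Summits.Ventures.DiscreteObjects.PP12.AffineSTDAction
import Summits.Ventures.DiscreteObjects.STD.ClassRegularQuotient

/-!
# The quotient of a projective plane by an elation of prime order is a symmetric transversal design (kernel)
Framing: lottery ticket; floor = certified bounds/negative ranges.

Cell pub-namedobj (venture DiscreteObjects), target (M), designs gen 9.  **`exists_quotientSTD_of_elation`.**  Let `σ`
be a collineation of a finite projective plane of order `n` with axis `l` and centre `c ∈ l` (an elation), `σ ≠ 1`,
`σ ^ p = 1` on points with `p` prime.  Then `p ∣ n`, and the `⟨σ⟩`-orbits of the points off `l` (classed by the lines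
through `c`) and of the lines avoiding `c` (classed by their point on `l`) form an STD_p[n; n/p]: there are an array
`π : STD.IncArray n (n/p)` with `STD.IsSTD p π` and SURJECTIVE maps `gP : {x ∉ l} → Fin n × Fin (n/p)`,
`gL : {m ∌ c} → Fin n × Fin (n/p)` whose fibres are exactly the `⟨σ⟩`-orbits, such that the STD point `gP x` lies on
the STD block `gL m` iff some point of the orbit of `x` lies on `m`.  Proof: the affine STD₁[n;n] of the flag
(`AffineSTD`), the class-fixing fixed-point-free label action of `σ` (`AffineSTDAction`) and the class-regular quotient
theorem (`STD.ClassRegularQuotient`).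

Census corollaries for a projective plane of order 12 (target M, family B1, the two live prime orders):
* **`exists_quotientSTD2_of_involution`** — an involution `σ ≠ 1` is an elation (`elation_of_sq`, p222353) and the plane
  is a double cover of an STD₂[12;6] (`IncArray 12 6`, `IsSTD 2`): the reduction step of family F-INV2 ('PP(12) with an
  involution ⇒ STD₂[12;6] with a consistent GF(2) lift', Suetake 2002/2009) is now a KERNEL theorem — the lift
  condition itself stays computational;
* **`exists_quotientSTD3_of_elation_order3`** — an elation of order 3 makes the plane a triple cover of an STD₃[12;4]
  (this cell is excluded in print: Janko–van Trung 1981; typed here as the first step of that exclusion).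
Classical (Jungnickel 1982; Suetake 2002); formalisation ours; no `sorry`.
-/

namespace Summit.Ventures.DiscreteObjects.PP12

open Configuration Finset Summit.Ventures.DiscreteObjects.STD
open scoped Classical

namespace Collineation

variable {P L : Type*} [Membership P L] [ProjectivePlane P L] [Fintype P] [Fintype L] (σ : Collineation P L)

/-- **The quotient of a finite projective plane by an elation of prime order `p` is an STD_p[n; n/p].**  See the
module docstring. -/
theorem exists_quotientSTD_of_elation {l : L} {c : P} (hl : σ.IsAxis l) (hc : σ.IsCenter c) (hcl : c ∈ l)
    (hne : σ.onPoints ≠ 1) {p : ℕ} (hp : p.Prime) (hq : σ.onPoints ^ p = 1) {n : ℕ}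
    (hn : ProjectivePlane.order P L = n) :
    p ∣ n ∧ ∃ (π : IncArray n (n / p)) (gP : {x : P // x ∉ l} → Fin n × Fin (n / p))
      (gL : {m : L // c ∉ m} → Fin n × Fin (n / p)),
      IsSTD p π ∧ Function.Surjective gP ∧ Function.Surjective gL ∧
      (∀ x x', gP x = gP x' ↔ ∃ t < p, (σ.onPoints ^ t) x.1 = x'.1) ∧
      (∀ m m', gL m = gL m' ↔ ∃ t < p, (σ.onLines ^ t) m.1 = m'.1) ∧
      (∀ x m, π (gP x).1 (gL m).1 (gP x).2 = (gL m).2 ↔ ∃ t < p, (σ.onPoints ^ t) x.1 ∈ m.1) := by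
  subst hn
  have hk : 0 < ProjectivePlane.order P L := lt_trans zero_lt_one (ProjectivePlane.one_lt_order P L)
  obtain ⟨hdvd, π', qP, qB, hSTD, hqPs, hqBs, hqP, hqB, hkey⟩ :=
    exists_classRegular_quotient (affArr hcl) (labelPermP hcl σ hl hc) (labelPermL hcl σ hl) hk
      (isSTD_one_affArr hcl) hp (affArr_labelPerm hcl σ hl hc) (labelPermP_pow hcl σ hl hc hq)
      (labelPermP_ne hcl σ hl hc hne)
  rw [one_mul] at hSTD
  refine ⟨hdvd, π', fun x => ((fP hcl x).1, qP (fP hcl x).1 (fP hcl x).2),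
    fun m => ((fL hcl m).1, qB (fL hcl m).1 (fL hcl m).2), hSTD, ?_, ?_, ?_, ?_, ?_⟩
  · -- every STD point is the image of a point off `l`
    rintro ⟨i, a'⟩
    obtain ⟨a, ha⟩ := hqPs i a'
    exact ⟨⟨ptOf hcl i a, ptOf_not_mem hcl i a⟩, by simp only [fP_ptOf, ha]⟩
  · -- every STD block is the image of a line avoiding `c`
    rintro ⟨j, b'⟩
    obtain ⟨b, hb⟩ := hqBs j b'
    exact ⟨⟨blkOf hcl j b, center_not_mem_blkOf hcl j b⟩, by simp only [fL_blkOf, hb]⟩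
  · -- the fibres of `gP` are the `σ`-orbits
    intro x x'
    constructor
    · intro h
      simp only [Prod.mk.injEq] at h
      obtain ⟨h1, h2⟩ := h
      rw [h1] at h2
      obtain ⟨t, ht, hta⟩ := (hqP _ _ _).1 h2
      refine ⟨t, ht, ?_⟩
      have e := ptOf_labelPermP_pow hcl σ hl hc (fP hcl x').1 t (fP hcl x).2
      rw [hta, ptOf_fP] at e
      have e2 : ptOf hcl (fP hcl x').1 (fP hcl x).2 = x.1 := by rw [← h1, ptOf_fP]
      rw [e2] at e
      exact e.symm
    · rintro ⟨t, ht, hx⟩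
      have e := ptOf_labelPermP_pow hcl σ hl hc (fP hcl x).1 t (fP hcl x).2
      rw [ptOf_fP, hx] at e
      have e3 := fP_ptOf hcl (fP hcl x).1 ((labelPermP hcl σ hl hc (fP hcl x).1 ^ t) (fP hcl x).2)
      have e4 : fP hcl x' = ((fP hcl x).1, (labelPermP hcl σ hl hc (fP hcl x).1 ^ t) (fP hcl x).2) := by
        rw [← e3]; congr 1; exact Subtype.ext e.symm
      simp only [e4, Prod.mk.injEq, true_and]
      exact (hqP _ _ _).2 ⟨t, ht, rfl⟩
  · -- the fibres of `gL` are the `σ`-orbits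
    intro m m'
    constructor
    · intro h
      simp only [Prod.mk.injEq] at h
      obtain ⟨h1, h2⟩ := h
      rw [h1] at h2
      obtain ⟨t, ht, htb⟩ := (hqB _ _ _).1 h2
      refine ⟨t, ht, ?_⟩
      have e := blkOf_labelPermL_pow hcl σ hl (fL hcl m').1 t (fL hcl m).2
      rw [htb, blkOf_fL] at e
      have e2 : blkOf hcl (fL hcl m').1 (fL hcl m).2 = m.1 := by rw [← h1, blkOf_fL]
      rw [e2] at e
      exact e.symm
    · rintro ⟨t, ht, hm⟩
      have e := blkOf_labelPermL_pow hcl σ hl (fL hcl m).1 t (fL hcl m).2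
      rw [blkOf_fL, hm] at e
      have e3 := fL_blkOf hcl (fL hcl m).1 ((labelPermL hcl σ hl (fL hcl m).1 ^ t) (fL hcl m).2)
      have e4 : fL hcl m' = ((fL hcl m).1, (labelPermL hcl σ hl (fL hcl m).1 ^ t) (fL hcl m).2) := by
        rw [← e3]; congr 1; exact Subtype.ext e.symm
      simp only [e4, Prod.mk.injEq, true_and]
      exact (hqB _ _ _).2 ⟨t, ht, rfl⟩
  · -- incidence: some point of the orbit of `x` lies on `m`
    intro x m
    show π' (fP hcl x).1 (fL hcl m).1 (qP (fP hcl x).1 (fP hcl x).2) = qB (fL hcl m).1 (fL hcl m).2 ↔ _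
    rw [hkey, hqB]
    refine exists_congr fun t => and_congr_right fun _ => ?_
    rw [← inc_pow (affArr hcl) (labelPermP hcl σ hl hc) (labelPermL hcl σ hl) (affArr_labelPerm hcl σ hl hc),
      affArr_apply_eq_iff hcl, ptOf_labelPermP_pow hcl σ hl hc, ptOf_fP, blkOf_fL]

section OrderTwelve

variable (h12 : ProjectivePlane.order P L = 12)
include h12

/-- **PP(12) with an involution is a double cover of an STD₂[12;6]** (family F-INV2, reduction step, kernel).  For a
collineation `σ ≠ 1` of a projective plane of order 12 with `σ² = 1` on points there are an axis `l` and a centre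
`c ∈ l` (`elation_of_sq`), an STD₂[12;6] `π`, and surjections from the points off `l` / the lines avoiding `c` onto
its points / blocks, with fibres `{x, σ x}` / `{m, σ m}`, such that an STD point lies on an STD block iff `x ∈ m` or
`σ x ∈ m`. -/
theorem exists_quotientSTD2_of_involution (hne : σ.onPoints ≠ 1) (hq : σ.onPoints ^ 2 = 1) :
    ∃ (l : L) (c : P), σ.IsAxis l ∧ σ.IsCenter c ∧ c ∈ l ∧
      ∃ (π : IncArray 12 6) (gP : {x : P // x ∉ l} → Fin 12 × Fin 6) (gL : {m : L // c ∉ m} → Fin 12 × Fin 6),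
        IsSTD 2 π ∧ Function.Surjective gP ∧ Function.Surjective gL ∧
        (∀ x x', gP x = gP x' ↔ ∃ t < 2, (σ.onPoints ^ t) x.1 = x'.1) ∧
        (∀ m m', gL m = gL m' ↔ ∃ t < 2, (σ.onLines ^ t) m.1 = m'.1) ∧
        (∀ x m, π (gP x).1 (gL m).1 (gP x).2 = (gL m).2 ↔ ∃ t < 2, (σ.onPoints ^ t) x.1 ∈ m.1) := by
  obtain ⟨l, c, hl, hc, hcl⟩ := σ.elation_of_sq h12 hne hq
  exact ⟨l, c, hl, hc, hcl, (σ.exists_quotientSTD_of_elation hl hc hcl hne Nat.prime_two hq h12).2⟩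

/-- **PP(12) with an elation of order 3 is a triple cover of an STD₃[12;4]** (excluded in print, Janko–van Trung 1981;
the census types the reduction).  For a collineation `σ ≠ 1` with axis `l`, centre `c ∈ l` and `σ³ = 1` on points
there are an STD₃[12;4] `π` and surjections from the points off `l` / the lines avoiding `c` onto its points / blocks,
with the `⟨σ⟩`-orbits as fibres, such that an STD point lies on an STD block iff some point of the orbit lies on the
line. -/
theorem exists_quotientSTD3_of_elation_order3 {l : L} {c : P} (hl : σ.IsAxis l) (hc : σ.IsCenter c) (hcl : c ∈ l)
    (hne : σ.onPoints ≠ 1) (hq : σ.onPoints ^ 3 = 1) :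
    ∃ (π : IncArray 12 4) (gP : {x : P // x ∉ l} → Fin 12 × Fin 4) (gL : {m : L // c ∉ m} → Fin 12 × Fin 4),
      IsSTD 3 π ∧ Function.Surjective gP ∧ Function.Surjective gL ∧
      (∀ x x', gP x = gP x' ↔ ∃ t < 3, (σ.onPoints ^ t) x.1 = x'.1) ∧
      (∀ m m', gL m = gL m' ↔ ∃ t < 3, (σ.onLines ^ t) m.1 = m'.1) ∧
      (∀ x m, π (gP x).1 (gL m).1 (gP x).2 = (gL m).2 ↔ ∃ t < 3, (σ.onPoints ^ t) x.1 ∈ m.1) :=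
  (σ.exists_quotientSTD_of_elation hl hc hcl hne Nat.prime_three hq h12).2

end OrderTwelve

end Collineation

end Summit.Ventures.DiscreteObjects.PP12
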